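import Mathlib
import Literature.AlgebraicGeometry.Resolution.NearPointTauOrigin
import HarnessLib

/-!
# The directrix at a near origin is a graph over the old directrix

Topic: `Literature/AlgebraicGeometry/Resolution`. Refinement of [CoP1] (12) / Prop. 4.2 (b)
(`NearPointTauOrigin.hironakaTauAt_le_hironakaTauAt_origin`: `τ(x′) ≥ τ(x)` at the origin `x′`
of a chart of the blowing up of the closed point `x`), needed to follow an infinite chain of near
points with `τ = 2 = d − 1` in the termination proof of Cossart–Piltant 2008, Prop. 4.4 (p. 11):
if `τ(x) = τ(x′) = d − 1` and no initial form of `J` involves `Y_j` (the coordinates are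
ADAPTED: `T_x = <Y_i : i ≠ j>`), then the directrix at `x′` (w.r.t. the chart parameters
`(c_j; e_i = c_i/c_j)`) is the GRAPH **`T_{x′} = <Y_i′ + λ_i U : i ≠ j>`** for unique scalars
`λ_i ∈ k(x′)` (`U = Y_j′` the exceptional parameter): killing `U` maps `T_{x′}` isomorphically
onto `<Y_i : i ≠ j> ⊇ θ_* T_x`, by (12) and a dimension count. In particular the next near point
lies again in the `c_j`-chart, and re-adapting the coordinates is the substitution
`e_i ↦ e_i + λ̃_i c_j`.

* `eq_killDual_add` — `ℓ = kill(ℓ) + ℓ(e_j) Y_j`;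
* `finrank_ker_applyₗ_single_add_one` — `dim {ℓ : ℓ(e_j) = 0} = d − 1` (evaluation at `e_j` is
  Mathlib's `LinearMap.applyₗ (Pi.single j 1)`);
* `exists_directrix_eq_span_graph` — the theorem.

## Sources

* V. Cossart, O. Piltant, J. Algebra 320 (2008), proof of Prop. 4.2 (b), Lemma 4.3 (3), (12),
  and proof of Prop. 4.4 p. 11. [CossartPiltant2008]
* H. Hironaka, *Characteristic polyhedra of singularities*, J. Math. Kyoto Univ. 7 (1967). [Hironaka1967]
-/

noncomputable section

open IsLocalRing

namespace Literature.AlgebraicGeometry.Resolution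

universe u

/-! ## Linear algebra of `killDual` -/

section Kill

variable {k : Type*} [Field k] {d : ℕ}

/-- The evaluation `ℓ ↦ ℓ(e_j)` on linear forms is Mathlib's `LinearMap.applyₗ (Pi.single j 1)`;
its value. [folklore] -/
theorem applyₗ_single_apply (j : Fin d) (ℓ : Module.Dual k (Fin d → k)) :
    LinearMap.applyₗ (R := k) (M₂ := k) (Pi.single j 1 : Fin d → k) ℓ = ℓ (Pi.single j 1) := rfl

/-- `ℓ = kill_j(ℓ) + ℓ(e_j) · Y_j`. [folklore] -/
theorem eq_killDual_add (j : Fin d) (ℓ : Module.Dual k (Fin d → k)) :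
    ℓ = killDual j ℓ + ℓ (Pi.single j 1) • (LinearMap.proj j : Module.Dual k (Fin d → k)) := by
  simp [killDual]

/-- `kill_j(ℓ)(e_j) = 0`. [folklore] -/
theorem applyₗ_single_killDual (j : Fin d) (ℓ : Module.Dual k (Fin d → k)) :
    LinearMap.applyₗ (R := k) (M₂ := k) (Pi.single j 1 : Fin d → k) (killDual j ℓ) = 0 := by
  rw [applyₗ_single_apply, killDual_single, if_pos rfl]

/-- `Y_i(e_j) = δ_{ij}`. [folklore] -/
theorem proj_apply_single (i j : Fin d) :
    (LinearMap.proj i : Module.Dual k (Fin d → k)) (Pi.single j 1) = if j = i then 1 else 0 := by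
  simp [Pi.single_apply, eq_comm]

/-- **`dim {ℓ : ℓ(e_j) = 0} = d − 1`.** [folklore] -/
theorem finrank_ker_applyₗ_single_add_one (j : Fin d) :
    Module.finrank k (LinearMap.ker (LinearMap.applyₗ (R := k) (M₂ := k) (Pi.single j 1 : Fin d → k))) + 1 = d := by
  have hsurj : LinearMap.range (LinearMap.applyₗ (R := k) (M₂ := k) (Pi.single j 1 : Fin d → k)) = ⊤ := by
    rw [eq_top_iff]
    rintro a -
    refine ⟨a • (LinearMap.proj j : Module.Dual k (Fin d → k)), ?_⟩
    rw [map_smul, applyₗ_single_apply, proj_apply_single, if_pos rfl, smul_eq_mul, mul_one]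
  have h := LinearMap.finrank_range_add_finrank_ker (LinearMap.applyₗ (R := k) (M₂ := k) (Pi.single j 1 : Fin d → k))
  rw [hsurj, finrank_top, Module.finrank_self, Subspace.dual_finrank_eq,
    Module.finrank_fin_fun] at h
  omega

/-- The forms `Y_i`, `i ≠ j`, with prescribed `U`-coefficients are linearly independent. [folklore] -/
theorem linearIndependent_proj_add_smul (j : Fin d) (lam : {i : Fin d // i ≠ j} → k) :
    LinearIndependent k fun i : {i : Fin d // i ≠ j} =>
      (LinearMap.proj i.1 : Module.Dual k (Fin d → k)) + lam i • LinearMap.proj j := by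
  rw [linearIndependent_iff']
  intro s g hsum i hi
  have h := congrArg (fun ℓ : Module.Dual k (Fin d → k) => ℓ (Pi.single i.1 1)) hsum
  simp only [LinearMap.coe_sum, Finset.sum_apply, LinearMap.smul_apply, LinearMap.add_apply,
    proj_apply_single, LinearMap.zero_apply, smul_eq_mul] at h
  rw [Finset.sum_eq_single i] at h
  · simpa [i.2] using h
  · intro i' _ hne
    have h1 : (i.1 = i'.1) = False := by
      simp only [eq_iff_iff, iff_false]; exact fun h' => hne (Subtype.ext h'.symm)
    simp [h1, i.2]
  · intro hi'; exact absurd hi hi'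

end Kill

/-! ## The graph lemma -/

section Graph

variable {R : Type u} [CommRing R] [IsRegularLocalRing R] {d : ℕ}

set_option maxHeartbeats 400000 in
/-- **The directrix at a near origin with `τ(x′) = τ(x) = d − 1` is a graph over `<Y_i : i ≠ j>`.**
In the situation of `hironakaTauAt_le_hironakaTauAt_origin` (origin `x′` of the chart `B_j`,
`μ ≥ 1`, `J′ ⊆ 𝔪_L^μ` containing the weak transforms, no initial form of `J` involving `Y_j`),
if moreover `τ(x) = τ(x′) = d − 1`, then there are scalars `λ_i ∈ k(x′)`, `i ≠ j`, with
`T_{x′} = <Y_i′ + λ_i Y_j′ : i ≠ j>` (initial forms at `x′` w.r.t. `originFamily c j L`).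
[cite: CossartPiltant2008, proof of Prop. 4.2 (b), (12); proof of Prop. 4.4 p. 11] -/
theorem exists_directrix_eq_span_graph (hd : (maximalIdeal R).spanFinrank = d)
    (c : Fin d → R) (hc : Ideal.span (Set.range c) = maximalIdeal R) (j : Fin d)
    (𝔴 : Ideal (chartRing c j)) [𝔴.IsPrime] (h𝔴 : 𝔴.comap (chartBase c j) = maximalIdeal R)
    (he : ∀ i, i ≠ j → chartGen c j i ∈ 𝔴)
    (L : Type u) [CommRing L] [IsLocalRing L] [Algebra (chartRing c j) L]
    [IsLocalization.AtPrime L 𝔴]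
    (θ : ResidueField R →+* ResidueField L)
    (hθ : ∀ r, θ (residue R r) =
      residue L ((algebraMap (chartRing c j) L : chartRing c j →+* L) (chartBase c j r)))
    {J : Ideal R} {μ : ℕ} (hμ : 1 ≤ μ) {J' : Ideal L}
    (hJ' : ∀ F : MvPolynomial (Fin d) R, F.IsHomogeneous μ → MvPolynomial.eval c F ∈ J →
      (algebraMap (chartRing c j) L : chartRing c j →+* L)
        (MvPolynomial.eval₂Hom (chartBase c j) (fun i => chartGen c j i) F) ∈ J')
    (hnear : J' ≤ maximalIdeal L ^ μ)
    (hall : ∀ G ∈ initialForms c J μ, ∀ m ∈ G.support, m j = 0)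
    (hτ : hironakaTauAt c J μ + 1 = d) (hτ' : hironakaTauAt (originFamily c j L) J' μ + 1 = d) :
    ∃ lam : {i : Fin d // i ≠ j} → ResidueField L,
      directrix (ResidueField L)
          (initialForms (originFamily c j L) J' μ : Set (MvPolynomial (Fin d) (ResidueField L))) =
        Submodule.span (ResidueField L) (Set.range fun i : {i : Fin d // i ≠ j} =>
          (LinearMap.proj i.1 : Module.Dual (ResidueField L) (Fin d → ResidueField L)) +
            lam i • LinearMap.proj j) := by
  classical
  set kL := ResidueField L
  -- `θ` is an isomorphism and `τ(θ_* cl J) = τ(x)`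
  have hcompθ : (residue L).comp ((algebraMap (chartRing c j) L : chartRing c j →+* L).comp
      (chartBase c j)) = θ.comp (residue R) := by
    ext r
    rw [RingHom.comp_apply, RingHom.comp_apply, RingHom.comp_apply, hθ]
  have hθsurj : Function.Surjective θ := by
    have h := residue_comp_surjective_origin c j 𝔴 h𝔴 he L
    rw [hcompθ, RingHom.coe_comp] at h
    exact Function.Surjective.of_comp h
  have hθbij : Function.Bijective θ := ⟨θ.injective, hθsurj⟩
  have hcoe : ((RingEquiv.ofBijective θ hθbij : ResidueField R ≃+* kL) :
      ResidueField R →+* kL) = θ := RingHom.ext fun x => rfl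
  have hτeq : hironakaTau kL (MvPolynomial.map θ ''
      (initialForms c J μ : Set (MvPolynomial (Fin d) (ResidueField R)))) = hironakaTauAt c J μ := by
    rw [← hcoe]
    exact hironakaTau_image_map_eq (RingEquiv.ofBijective θ hθbij) _
  -- `T′ := T_{x′}`: `cl_μ(J′) ⊆ k[T′]`, `dim T′ = τ(x′) = d − 1`
  set S' : Set (MvPolynomial (Fin d) kL) :=
    ((initialForms (originFamily c j L) J' μ : Submodule kL (MvPolynomial (Fin d) kL)) :
      Set (MvPolynomial (Fin d) kL))
  set T' : Submodule kL (Module.Dual kL (Fin d → kL)) := directrix kL S' with hT'def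
  have hS'T' : S' ⊆ linearFormsSubalgebra kL T' := subset_linearFormsSubalgebra_directrix kL S'
  have hT' : Module.finrank kL T' + 1 = d := hτ'
  -- (12): `θ_* cl_μ(J) ⊆ k[kill(T′)]`
  have hsub : MvPolynomial.map θ '' (initialForms c J μ : Set (MvPolynomial (Fin d) (ResidueField R))) ⊆
      linearFormsSubalgebra kL (T'.map (killDual j)) := by
    rintro _ ⟨G, hG, rfl⟩
    obtain ⟨H, hH⟩ := exists_add_X_mul_mem_initialForms_origin hd c hc j 𝔴 h𝔴 he L θ hθ hμ hJ'
      hnear hG (hall G hG)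
    have hkill : MvPolynomial.aeval (fun i => if i = j then (0 : MvPolynomial (Fin d) kL)
        else MvPolynomial.X i) (MvPolynomial.map θ G + MvPolynomial.X j * H) =
        MvPolynomial.map θ G := by
      rw [map_add, map_mul, MvPolynomial.aeval_X, if_pos rfl, zero_mul, add_zero]
      refine aeval_kill_eq_self_of_forall_apply_eq_zero j fun m hm => hall G hG m ?_
      exact MvPolynomial.support_map_subset _ _ hm
    rw [← hkill]
    exact apply_mem_linearFormsSubalgebra_map _ (killDual j) (aeval_kill_linearFormPoly j) T'
      (hS'T' hH)
  -- dimension count: `kill(T′) = {ℓ : ℓ(e_j) = 0}`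
  set K : Submodule kL (Module.Dual kL (Fin d → kL)) :=
    LinearMap.ker (LinearMap.applyₗ (R := kL) (M₂ := kL) (Pi.single j 1 : Fin d → kL)) with hKdef
  have hKd : Module.finrank kL K + 1 = d := finrank_ker_applyₗ_single_add_one j
  have hmapK : T'.map (killDual j) ≤ K := by
    rintro _ ⟨t, -, rfl⟩
    exact applyₗ_single_killDual j t
  have hge : hironakaTauAt c J μ ≤ Module.finrank kL (T'.map (killDual j)) :=
    hτeq ▸ hironakaTau_le_finrank_of_subset kL hsub
  have hmapK_eq : T'.map (killDual j) = K := by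
    refine Submodule.eq_of_le_of_finrank_eq hmapK (le_antisymm (Submodule.finrank_mono hmapK) ?_)
    omega
  -- the graph: `Y_i ∈ K = kill(T′)`, so `Y_i = kill(t_i)` with `t_i = Y_i + t_i(e_j) Y_j ∈ T′`
  have hex : ∀ i : {i : Fin d // i ≠ j}, ∃ t ∈ T',
      killDual j t = (LinearMap.proj i.1 : Module.Dual kL (Fin d → kL)) := by
    intro i
    have hmem : (LinearMap.proj i.1 : Module.Dual kL (Fin d → kL)) ∈ K := by
      rw [hKdef, LinearMap.mem_ker, applyₗ_single_apply, proj_apply_single, if_neg (Ne.symm i.2)]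
    rw [← hmapK_eq] at hmem
    obtain ⟨t, ht, hkt⟩ := hmem
    exact ⟨t, ht, hkt⟩
  choose t ht hkt using hex
  refine ⟨fun i => t i (Pi.single j 1), ?_⟩
  have htgraph : ∀ i : {i : Fin d // i ≠ j},
      (LinearMap.proj i.1 : Module.Dual kL (Fin d → kL)) + t i (Pi.single j 1) • LinearMap.proj j =
        t i := by
    intro i
    conv_rhs => rw [eq_killDual_add j (t i)]
    rw [hkt i]
  -- `T′ = span {t_i}` by independence and dimension
  have hspan_le : Submodule.span kL (Set.range fun i : {i : Fin d // i ≠ j} =>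
      (LinearMap.proj i.1 : Module.Dual kL (Fin d → kL)) + t i (Pi.single j 1) • LinearMap.proj j) ≤
      T' := by
    rw [Submodule.span_le]
    rintro _ ⟨i, rfl⟩
    change (LinearMap.proj i.1 : Module.Dual kL (Fin d → kL)) + t i (Pi.single j 1) • LinearMap.proj j
      ∈ T'
    rw [htgraph i]
    exact ht i
  have hli := linearIndependent_proj_add_smul (k := kL) j fun i => t i (Pi.single j 1)
  have hcard : Fintype.card {i : Fin d // i ≠ j} + 1 = d := by
    rw [Fintype.card_subtype_compl, Fintype.card_fin, Fintype.card_unique]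
    have : 0 < d := Fin.pos j
    omega
  have hfin : Module.finrank kL (Submodule.span kL (Set.range fun i : {i : Fin d // i ≠ j} =>
      (LinearMap.proj i.1 : Module.Dual kL (Fin d → kL)) + t i (Pi.single j 1) • LinearMap.proj j)) =
      Fintype.card {i : Fin d // i ≠ j} := finrank_span_eq_card hli
  have hgoal : Module.finrank kL (Submodule.span kL (Set.range fun i : {i : Fin d // i ≠ j} =>
      (LinearMap.proj i.1 : Module.Dual kL (Fin d → kL)) + t i (Pi.single j 1) • LinearMap.proj j)) =
      Module.finrank kL T' := by
    rw [hfin]; omega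
  exact (Submodule.eq_of_le_of_finrank_eq hspan_le hgoal).symm

end Graph

end Literature.AlgebraicGeometry.Resolution

end
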